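/-
Copyright (c) 2026. All rights reserved.
Released under Apache 2.0 license as described in the file LICENSE.
-/
import Summits.Langlands.Langlands.Theorems.SoloInformedRepairD2Cris
import Literature.NumberTheory.GaloisRepresentations.PstWeilDeligneCyclotomicWeight
import Literature.NumberTheory.PAdicHodge.BmaxPlusTRegular
import Literature.NumberTheory.PAdicHodge.BmaxPlusTheta
import Mathlib.LinearAlgebra.Dual.Lemmas
import HarnessLib

/-!
# Repair D2-cris — the rank-one sanity certificate: `D_cris` of the cyclotomic character over the
# constructed `B_max(F) = A_max[1/t]`

Companion to `Theorems/SoloInformedRepairD2Cris` (the clause `CrystallineCompatibleAt`, typed over the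
constructed `D2Cris.Bmax F p` with `D2Cris.Dcris`, `D2Cris.phiDcris`).  The one check of that file's
NORMALISATION that the kernel can perform today without any admissibility theory: for the cyclotomic
character `χ : Γ_F → GL_1(ℚ̄_p)` (`FramedGaloisRep.cyclotomicPadicAlgCl F p`),
* `e ⊗ t⁻¹ ∈ D_cris(χ)` (`single_tmul_tInv_mem_Dcris`): `σ(e ⊗ t⁻¹) = χ(σ)e ⊗ χ(σ)⁻¹t⁻¹` and the
  `ℚ_p`-scalar `χ(σ)` moves across `⊗_{ℚ_p}`;
* `φ_D (e ⊗ t⁻¹) = p⁻¹ · (e ⊗ t⁻¹)` (`phiDcris_single_tmul_tInv`): `φ t = p t`;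
* `e ⊗ t⁻¹ ≠ 0` as soon as Fontaine's `θ` is surjective on `𝒪_{ℂ_F}` (`single_tmul_tInv_ne_zero`; then `t`
  is a non-zero-divisor of `A_max` by the tree's `eq_zero_of_tBmax_mul_eq_zero`, so `A_max → A_max[1/t]` is
  injective and `B_max(F) ≠ 0`).
So `D_cris(ℚ_p(1))` contains a `φ`-eigenvector of eigenvalue `p⁻¹`, whence `φ^f = q⁻¹` on it (`q = p^f`) —
the value of the cyclotomic compatible system on a GEOMETRIC Frobenius at a place of residue cardinality
`q`, consistent with the geometric normalisation `charpoly (φ^f) = (∏ (X - ι⁻¹ a))^f` of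
`CrystallineCompatibleAt` (the summit's `SatakeFrobCompatibleAt` pins the ARITHMETIC Frobenius to
`∏ (X - (ι⁻¹ a)⁻¹)`).  That `D_cris(ℚ_p(1))` is EXACTLY the line `ℚ̄_p · (e ⊗ t⁻¹)` is the rank-one case
of `B_max^{Γ_F} = F₀` (Fontaine, Colmez) and is not claimed here.
-/

noncomputable section

open scoped MatrixGroups TensorProduct
open Field WittVector
open Literature.NumberTheory.GaloisRepresentations Literature.NumberTheory.PAdicHodge

namespace Summit.Langlands.Langlands.Theorems

namespace D2Cris

section Cyclotomic

variable {F : Type} [Field F] {p : ℕ} [Fact p.Prime]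

/-- The `ℚ_p`-valued cyclotomic character `σ ↦ χ(σ) ∈ ℤ_p^× ⊂ ℚ_p`. [folklore] -/
def cycQp (σ : absoluteGaloisGroup F) : ℚ_[p] :=
  (((GaloisRep.cyclotomicCharacter F p σ : ℤ_[p]ˣ) : ℤ_[p]) : ℚ_[p])

/-- `χ(σ) ≠ 0` in `ℚ_p`. [folklore] -/
theorem cycQp_ne_zero (σ : absoluteGaloisGroup F) : cycQp (p := p) σ ≠ 0 :=
  PadicInt.coe_ne_zero.2 (Units.ne_zero _)

/-- The cyclotomic matrix acts on `e = Pi.single 0 1` by the `ℚ_p`-scalar `χ(σ)`. [folklore] -/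
theorem toLin'_cyclotomic_single (σ : absoluteGaloisGroup F) :
    Matrix.toLin' ((FramedGaloisRep.cyclotomicPadicAlgCl F p σ : GL (Fin 1) (PadicAlgCl p)) :
        Matrix (Fin 1) (Fin 1) (PadicAlgCl p)) (Pi.single 0 1) =
      cycQp (p := p) σ • (Pi.single 0 1 : Fin 1 → PadicAlgCl p) := by
  ext i
  obtain rfl : i = 0 := Subsingleton.elim _ _
  simp [Matrix.toLin'_apply, Matrix.mulVec, dotProduct, cycQp, Algebra.smul_def]

end Cyclotomic

variable {F : Type} [Field F] [ValuativeRel F] [TopologicalSpace F] [IsNonarchimedeanLocalField F]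
  [CharZero F] {p : ℕ} [Fact p.Prime] [Fact (¬ IsUnit (p : integerC F))]
  [IsAdicComplete (Ideal.span {(p : integerC F)}) (integerC F)]

/-- **`t⁻¹ ∈ B_max(F) = A_max[1/t]`.** [cite: FontaineAsterisque223III, Exp. II §2.3] -/
def tInv : Bmax F p := (((isUnit_algebraMap_tBmax (F := F) (p := p)).unit⁻¹ : (Bmax F p)ˣ) : Bmax F p)

/-- `t · t⁻¹ = 1`. [folklore] -/
theorem algebraMap_tBmax_mul_tInv :
    algebraMap (BmaxPlus F p) (Bmax F p) tBmax * tInv = 1 :=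
  (isUnit_algebraMap_tBmax (F := F) (p := p)).mul_val_inv

/-- The `ℚ_p`-algebra map of `B_max(F)` is `qpToBmax`. [folklore] -/
theorem algebraMap_padic_eq (c : ℚ_[p]) : algebraMap ℚ_[p] (Bmax F p) c = qpToBmax F p c := rfl

/-- `ℤ_p → B_max(F)` is the restriction of the `ℚ_p`-structure. [folklore] -/
theorem zpToBmax_eq_algebraMap (x : ℤ_[p]) :
    zpToBmax F p x = algebraMap ℚ_[p] (Bmax F p) (x : ℚ_[p]) := by
  rw [algebraMap_padic_eq, ← qpToBmax_comp_algebraMap, RingHom.comp_apply]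
  rfl

/-- **`σ t⁻¹ = χ(σ)⁻¹ t⁻¹`** in `B_max(F)`. [cite: FontaineAsterisque223III, Exp. II §2.3] -/
theorem galBmax_tInv (σ : absoluteGaloisGroup F) :
    galBmax (F := F) (p := p) σ tInv = algebraMap ℚ_[p] (Bmax F p) (cycQp σ)⁻¹ * tInv := by
  have hT : galBmax (F := F) (p := p) σ (algebraMap (BmaxPlus F p) (Bmax F p) tBmax) =
      algebraMap ℚ_[p] (Bmax F p) (cycQp σ) * algebraMap (BmaxPlus F p) (Bmax F p) tBmax := by
    rw [galBmax_algebraMap, galBmaxPlus_tBmax, map_mul, cycQp, ← zpToBmax_eq_algebraMap]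
    rfl
  have h1 : galBmax (F := F) (p := p) σ tInv *
      (algebraMap ℚ_[p] (Bmax F p) (cycQp σ) * algebraMap (BmaxPlus F p) (Bmax F p) tBmax) = 1 := by
    rw [← hT, ← map_mul, mul_comm, algebraMap_tBmax_mul_tInv, map_one]
  have h2 : algebraMap ℚ_[p] (Bmax F p) (cycQp σ) * algebraMap (BmaxPlus F p) (Bmax F p) tBmax *
      (algebraMap ℚ_[p] (Bmax F p) (cycQp σ)⁻¹ * tInv) = 1 := by
    calc _ = (algebraMap ℚ_[p] (Bmax F p) (cycQp σ) * algebraMap ℚ_[p] (Bmax F p) (cycQp σ)⁻¹) *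
          (algebraMap (BmaxPlus F p) (Bmax F p) tBmax * tInv) := by ring
      _ = 1 := by rw [← map_mul, mul_inv_cancel₀ (cycQp_ne_zero σ), map_one, one_mul,
          algebraMap_tBmax_mul_tInv]
  exact left_inv_eq_right_inv h1 h2

/-- **`φ t⁻¹ = p⁻¹ t⁻¹`** in `B_max(F)`. [cite: FontaineAsterisque223III, Exp. II §2.3] -/
theorem frobBmax_tInv :
    frobBmax F p tInv = algebraMap ℚ_[p] (Bmax F p) (p : ℚ_[p])⁻¹ * tInv := by
  have hp : (p : ℚ_[p]) ≠ 0 := Nat.cast_ne_zero.2 (Fact.out : p.Prime).ne_zero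
  have hT : frobBmax F p (algebraMap (BmaxPlus F p) (Bmax F p) tBmax) =
      algebraMap ℚ_[p] (Bmax F p) (p : ℚ_[p]) * algebraMap (BmaxPlus F p) (Bmax F p) tBmax := by
    rw [frobBmax_algebraMap, frobBmaxPlus_tBmax, map_mul, map_natCast, map_natCast, map_natCast]
  have h1 : frobBmax F p tInv *
      (algebraMap ℚ_[p] (Bmax F p) (p : ℚ_[p]) * algebraMap (BmaxPlus F p) (Bmax F p) tBmax) = 1 := by
    rw [← hT, ← map_mul, mul_comm, algebraMap_tBmax_mul_tInv, map_one]
  have h2 : algebraMap ℚ_[p] (Bmax F p) (p : ℚ_[p]) * algebraMap (BmaxPlus F p) (Bmax F p) tBmax *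
      (algebraMap ℚ_[p] (Bmax F p) (p : ℚ_[p])⁻¹ * tInv) = 1 := by
    calc _ = (algebraMap ℚ_[p] (Bmax F p) (p : ℚ_[p]) * algebraMap ℚ_[p] (Bmax F p) (p : ℚ_[p])⁻¹) *
          (algebraMap (BmaxPlus F p) (Bmax F p) tBmax * tInv) := by ring
      _ = 1 := by rw [← map_mul, mul_inv_cancel₀ hp, map_one, one_mul, algebraMap_tBmax_mul_tInv]
  exact left_inv_eq_right_inv h1 h2

/-- The candidate period vector `e ⊗ t⁻¹ ∈ ℚ̄_p ⊗_{ℚ_p} B_max(F)`. [folklore] -/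
def tateVector : (Fin 1 → PadicAlgCl p) ⊗[ℚ_[p]] Bmax F p :=
  (Pi.single 0 1 : Fin 1 → PadicAlgCl p) ⊗ₜ[ℚ_[p]] (tInv : Bmax F p)

/-- **`e ⊗ t⁻¹ ∈ D_cris(χ)`** for the cyclotomic character `χ : Γ_F → GL_1(ℚ̄_p)`, over the constructed
`B_max(F)`: `(χ(σ) e) ⊗ (χ(σ)⁻¹ t⁻¹) = e ⊗ t⁻¹`. [cite: FontaineAsterisque223III, Exp. III §1.5] -/
theorem single_tmul_tInv_mem_Dcris :
    (tateVector : (Fin 1 → PadicAlgCl p) ⊗[ℚ_[p]] Bmax F p) ∈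
      Dcris (F := F) (p := p) (FramedGaloisRep.cyclotomicPadicAlgCl F p) := by
  intro σ
  show diagAct _ _ σ tateVector = tateVector
  simp only [diagAct, tateVector, TensorProduct.AlgebraTensorModule.map_tmul, AlgHom.toLinearMap_apply,
    toLin'_cyclotomic_single]
  rw [show galBmaxAlgHom (F := F) (p := p) σ tInv = galBmax σ tInv from rfl, galBmax_tInv,
    ← Algebra.smul_def, TensorProduct.smul_tmul, smul_smul, mul_inv_cancel₀ (cycQp_ne_zero σ), one_smul]

/-- **`φ_D (e ⊗ t⁻¹) = p⁻¹ · (e ⊗ t⁻¹)`** on `D_cris(χ)` over the constructed `B_max(F)`: the Frobenius of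
`D_cris(ℚ_p(1))` is `p⁻¹`, so `φ^f = q⁻¹` — the cyclotomic character on a GEOMETRIC Frobenius, as the
normalisation of `CrystallineCompatibleAt` requires. [cite: FontaineAsterisque223VIII, §2.3.7] -/
theorem phiDcris_single_tmul_tInv :
    ((phiDcris (F := F) (p := p) (FramedGaloisRep.cyclotomicPadicAlgCl F p)
        ⟨tateVector, single_tmul_tInv_mem_Dcris⟩ : Dcris (FramedGaloisRep.cyclotomicPadicAlgCl F p)) :
        (Fin 1 → PadicAlgCl p) ⊗[ℚ_[p]] Bmax F p) = (p : ℚ_[p])⁻¹ • tateVector := by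
  show phiTensor (frobBmaxAlgHom F p) tateVector = _
  simp only [phiTensor, tateVector, TensorProduct.AlgebraTensorModule.map_tmul, LinearMap.id_apply,
    AlgHom.toLinearMap_apply]
  rw [show frobBmaxAlgHom F p tInv = frobBmax F p tInv from rfl, frobBmax_tInv, ← Algebra.smul_def,
    TensorProduct.tmul_smul]

/-- `B_max(F) ≠ 0` once `θ` is surjective (`t` is then a non-zero-divisor of `A_max ≠ 0`, so
`A_max → A_max[1/t]` is injective). [cite: Colmez1998Annals, §III.2] -/
theorem nontrivial_bmax (hF : Function.Surjective (fontaineTheta (integerC F) p)) : Nontrivial (Bmax F p) := by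
  haveI : Nontrivial (BmaxPlus F p) := (thetaBmaxPlus F p).domain_nontrivial
  have ht : tBmax (F := F) (p := p) ∈ nonZeroDivisors (BmaxPlus F p) := by
    exact mem_nonZeroDivisors_iff.2 ⟨fun z hz => eq_zero_of_tBmax_mul_eq_zero hF hz,
      fun z hz => eq_zero_of_tBmax_mul_eq_zero hF (by rwa [mul_comm] at hz)⟩
  exact (IsLocalization.injective (M := Submonoid.powers (tBmax (F := F) (p := p))) (Bmax F p)
    ((Submonoid.powers_le).2 ht)).nontrivial

/-- **`e ⊗ t⁻¹ ≠ 0`** (given `θ` surjective): pure tensors of non-zero vectors over the field `ℚ_p` do not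
vanish (test against `φ ⊗ ψ` with `φ e = ψ t⁻¹ = 1`). [folklore] -/
theorem single_tmul_tInv_ne_zero (hF : Function.Surjective (fontaineTheta (integerC F) p)) :
    (tateVector : (Fin 1 → PadicAlgCl p) ⊗[ℚ_[p]] Bmax F p) ≠ 0 := by
  haveI := nontrivial_bmax (F := F) (p := p) hF
  have he : (Pi.single 0 1 : Fin 1 → PadicAlgCl p) ≠ 0 := by
    intro h
    simpa using congr_fun h 0
  have ht : (tInv : Bmax F p) ≠ 0 := Units.ne_zero _
  intro h
  obtain ⟨φ, hφ⟩ := Module.Projective.exists_dual_eq_one ℚ_[p] he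
  obtain ⟨ψ, hψ⟩ := Module.Projective.exists_dual_eq_one ℚ_[p] ht
  have := congrArg (fun x => TensorProduct.lid ℚ_[p] ℚ_[p] (TensorProduct.map φ ψ x)) h
  simp only [tateVector, TensorProduct.map_tmul, TensorProduct.lid_tmul, hφ, hψ, smul_eq_mul, mul_one,
    map_zero] at this
  exact one_ne_zero this

end D2Cris

end Summit.Langlands.Langlands.Theorems

end
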